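import Summits.CriticalPhenomena.Ising3DConformalLimit.Theses.PerfectScreening
import Literature.Barriers.CriticalPhenomena.IsingTrivialityFromDimensionFourProofs
import Summits.CriticalPhenomena.Ising3DConformalLimit.Theorems.PerfectScreeningCoulombImpliesNontrivialBlockLaw
import Summits.CriticalPhenomena.Ising3DConformalLimit.Theorems.PerfectScreeningCoulombImpliesNontrivialLeeYangPackage
import Summits.CriticalPhenomena.Ising3DConformalLimit.Theorems.PerfectScreeningCoulombImpliesNontrivialBlockFieldDomination
import Summits.CriticalPhenomena.Ising3DConformalLimit.Theorems.PerfectScreeningCoulombImpliesNontrivialBlockVariance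
import Summits.CriticalPhenomena.Ising3DConformalLimit.Theorems.PerfectScreeningCoulombImpliesNontrivialIsothermForcesGap
import Summits.CriticalPhenomena.Ising3DConformalLimit.Theorems.PerfectScreeningCoulombImpliesNontrivialGaussianKillsBinder

/-!
# `CoulombImpliesNontrivial` from the upper critical isotherm (line `SketchPub` assembled, sorry-free)

Crux `CoulombImpliesNontrivial` of route `PerfectScreening` (Ising3DConformalLimit), item
stmt-CriticalPhenomena-13885: `Coulomb lower bound c/‖x‖ ≤ ⟨σ₀σ_x⟩_{β_c} ⟹ every non-degenerate pointwise
scaling limit of criticalCorr 3 has U₄ ≢ 0`.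

This file is the SORRY-FREE ASSEMBLY of line `SketchPub` (Lee–Yang zero counting of the critical block spin,
idea card `isotherm-zero-count`) with its single residual turned into an explicit hypothesis: the crux follows,
BY NAME, from the residual S6

  `UCI := Coulomb → ∃ A h₀ > 0, ∀ h ∈ (0,h₀], m(β_c(3), h) ≤ A·h^{1/5}`

("δ ≤ 5 with amplitude at η = 0", the hyperscaling equality direction; open). Every other input is a landed
theorem of the line: S1a `stub_blockLaw`, S1b `stub_leeYangPackage`, S3 `stub_blockFieldDomination`,
S4 `stub_blockVariance`, S5 `stub_isothermForcesGap`, S7 `stub_gaussianKillsBinder`.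

Argument (`coulombImpliesNontrivial_of_upperCriticalIsotherm`): under Coulomb take a non-degenerate pointwise
limit `(ρ, S)` with `U₄^S ≡ 0`; S7 (with the two-sided `L⁵` variance S4) gives the block Binder coupling
`g_L = (3Σ_L² - ⟨M_L⁴⟩)/Σ_L² → 0`, while S5 (fed by the Lee–Yang package S1a+S1b, S3, S4 and UCI) gives for all
large `L` a Lee–Yang zero `θ₁ > 0` of `⟨cos(θM_L)⟩` with `θ₁²Σ_L ≤ C`, whence `g_L ≥ 12/C²` by Newman's first-zero
bound — contradiction.
-/

noncomputable section

namespace Summit.CriticalPhenomena.Ising3DConformalLimit.PerfectScreeningCoulombImpliesNontrivial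

open Literature.Probability.LatticeModels Filter Set Finset
open scoped Topology BigOperators

/-- The Lee–Yang package of the critical block `M_L = Σ_{x∈box 3 L} σ_x`, from S1a + S1b: `bᵢ ≥ 1`, degree
count, the `cos`/`exp` product formulas, the tilted mean, the variance identity, and Newman's first-zero bound. -/
theorem sketchPub_blockPackage (L : ℕ) :
    ∃ (m n : ℕ) (b : Fin n → ℝ), (∀ i, 1 ≤ b i) ∧ (m + 2 * n ≤ (2 * L + 1) ^ 3) ∧
      (∀ θ : ℝ, plusExpect 3 (criticalBeta 3) 0 (fun σ => Real.cos (θ * ∑ x ∈ box 3 L, spinAt x σ)) =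
        Real.cos θ ^ m * ∏ i, (1 - b i * Real.sin θ ^ 2)) ∧
      (∀ t : ℝ, plusExpect 3 (criticalBeta 3) 0 (fun σ => Real.exp (t * ∑ x ∈ box 3 L, spinAt x σ)) =
        Real.cosh t ^ m * ∏ i, (1 + b i * Real.sinh t ^ 2)) ∧
      (∀ t : ℝ, plusExpect 3 (criticalBeta 3) 0
          (fun σ => (∑ x ∈ box 3 L, spinAt x σ) * Real.exp (t * ∑ x ∈ box 3 L, spinAt x σ)) =
        (Real.cosh t ^ m * ∏ i, (1 + b i * Real.sinh t ^ 2)) *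
          (m * Real.tanh t + ∑ i, 2 * b i * Real.sinh t * Real.cosh t / (1 + b i * Real.sinh t ^ 2))) ∧
      ((m : ℝ) + 2 * ∑ i, b i = plusExpect 3 (criticalBeta 3) 0 (fun σ => (∑ x ∈ box 3 L, spinAt x σ) ^ 2)) ∧
      (∀ θ : ℝ, 0 < θ →
        plusExpect 3 (criticalBeta 3) 0 (fun σ => Real.cos (θ * ∑ x ∈ box 3 L, spinAt x σ)) = 0 →
        12 / θ ^ 4 ≤ 3 * (plusExpect 3 (criticalBeta 3) 0 (fun σ => (∑ x ∈ box 3 L, spinAt x σ) ^ 2)) ^ 2 -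
          plusExpect 3 (criticalBeta 3) 0 (fun σ => (∑ x ∈ box 3 L, spinAt x σ) ^ 4)) := by
  obtain ⟨p, hp0, hsymm, hpar, hmass, hlaw, hLY⟩ := stub_blockLaw L
  obtain ⟨m, n, b, hb, hdeg, hcos, hexp, htilt, hvar, -, hnewman⟩ :=
    stub_leeYangPackage ((2 * L + 1) ^ 3) p hp0 hsymm hpar hmass hLY
  refine ⟨m, n, b, hb, hdeg, fun θ => ?_, fun t => ?_, fun t => ?_, ?_, fun θ hθ hzero => ?_⟩
  · rw [hlaw (fun u => Real.cos (θ * u)), hcos]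
  · rw [hlaw (fun u => Real.exp (t * u)), hexp]
  · rw [hlaw (fun u => u * Real.exp (t * u)), htilt]
  · rw [hvar, hlaw (fun u => u ^ 2)]
  · rw [hlaw (fun u => Real.cos (θ * u))] at hzero
    rw [hlaw (fun u => u ^ 2), hlaw (fun u => u ^ 4)]
    exact hnewman θ hθ hzero

/-- The critical block variance is positive (`Σ_L ≥ 1`, Griffiths; tree `blockVariance_pos`). -/
theorem sketchPub_blockVariance_pos (L : ℕ) :
    0 < plusExpect 3 (criticalBeta 3) 0 (fun σ => (∑ x ∈ box 3 L, spinAt x σ) ^ 2) := by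
  simpa [Literature.Barriers.CriticalPhenomena.blockVariance,
    Literature.Barriers.CriticalPhenomena.blockSpin] using
    Literature.Barriers.CriticalPhenomena.blockVariance_pos (d := 3) (criticalBeta_nonneg 3) L

/-- A zero at the fluctuation scale (`θ²V ≤ C`) and Newman's bound (`12/θ⁴ ≤ K`) give `12/C² ≤ K/V²`. -/
theorem sketchPub_blockCoupling_ge {C θ V K : ℝ} (hθ : 0 < θ) (hV : 0 < V) (hθC : θ ^ 2 * V ≤ C)
    (hK : 12 / θ ^ 4 ≤ K) : 12 / C ^ 2 ≤ K / V ^ 2 := by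
  have hx : 0 < θ ^ 2 * V := by positivity
  have hC : 0 ≤ C := hx.le.trans hθC
  have h1 : (θ ^ 2 * V) ^ 2 ≤ C ^ 2 := by
    nlinarith [mul_nonneg (sub_nonneg.2 hθC) (add_nonneg hC hx.le)]
  have h2 : 12 / C ^ 2 ≤ 12 / (θ ^ 2 * V) ^ 2 :=
    div_le_div_of_nonneg_left (by norm_num) (by positivity) h1
  have h3 : (12 / θ ^ 4) / V ^ 2 = 12 / (θ ^ 2 * V) ^ 2 := by
    rw [div_div]
    congr 1
    ring
  have h4 : (12 / θ ^ 4) / V ^ 2 ≤ K / V ^ 2 := div_le_div_of_nonneg_right hK (by positivity)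
  rw [← h3] at h2
  exact h2.trans h4

/-- **The crux from the residual** (line `SketchPub` assembled): the UPPER CRITICAL ISOTHERM under the Coulomb
antecedent, `Coulomb → ∃ A h₀ > 0, ∀ h ∈ (0,h₀], m(β_c,h) ≤ A h^{1/5}`, implies `CoulombImpliesNontrivial` — by
name. (Lee–Yang package of the critical block S1a+S1b, GKS block-field domination S3, the `L⁵` variance S4, the
zero-forcing S5, the Gaussian-kills-Binder transfer S7, Newman's first-zero bound.) -/
theorem stub_cruxOfUpperCriticalIsotherm :
    ((∃ c : ℝ, 0 < c ∧ ∀ x : Site 3, x ≠ 0 → c / ‖x‖ ≤ criticalTwoPoint 3 x) →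
        ∃ A h₀ : ℝ, 0 < h₀ ∧ ∀ h : ℝ, 0 < h → h ≤ h₀ →
          magnetizationInField 3 (criticalBeta 3) h ≤ A * h ^ ((1:ℝ) / 5)) →
      Summit.CriticalPhenomena.Ising3DConformalLimit.Theses.PerfectScreening.CoulombImpliesNontrivial := by
  intro hUCI hC ρ S hρ hlim hnd
  by_contra hU4
  have hV := stub_blockVariance hC
  have htend := stub_gaussianKillsBinder hV ρ S hρ hlim hnd hU4
  have hpkg : ∀ L : ℕ, ∃ (m n : ℕ) (b : Fin n → ℝ), (∀ i, 1 ≤ b i) ∧ (m + 2 * n ≤ (2 * L + 1) ^ 3) ∧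
      (∀ θ : ℝ, plusExpect 3 (criticalBeta 3) 0 (fun σ => Real.cos (θ * ∑ x ∈ box 3 L, spinAt x σ)) =
        Real.cos θ ^ m * ∏ i, (1 - b i * Real.sin θ ^ 2)) ∧
      (∀ t : ℝ, plusExpect 3 (criticalBeta 3) 0 (fun σ => Real.exp (t * ∑ x ∈ box 3 L, spinAt x σ)) =
        Real.cosh t ^ m * ∏ i, (1 + b i * Real.sinh t ^ 2)) ∧
      (∀ t : ℝ, plusExpect 3 (criticalBeta 3) 0
          (fun σ => (∑ x ∈ box 3 L, spinAt x σ) * Real.exp (t * ∑ x ∈ box 3 L, spinAt x σ)) =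
        (Real.cosh t ^ m * ∏ i, (1 + b i * Real.sinh t ^ 2)) *
          (m * Real.tanh t + ∑ i, 2 * b i * Real.sinh t * Real.cosh t / (1 + b i * Real.sinh t ^ 2))) ∧
      ((m : ℝ) + 2 * ∑ i, b i =
        plusExpect 3 (criticalBeta 3) 0 (fun σ => (∑ x ∈ box 3 L, spinAt x σ) ^ 2)) := fun L => by
    obtain ⟨m, n, b, hb, hdeg, hcos, hexp, htilt, hvar, -⟩ := sketchPub_blockPackage L
    exact ⟨m, n, b, hb, hdeg, hcos, hexp, htilt, hvar⟩
  obtain ⟨C, L₀, hL⟩ := stub_isothermForcesGap hpkg stub_blockFieldDomination hV (hUCI hC)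
  -- `C > 0`: at `L₀` there is a zero `θ > 0` with `θ² Σ ≤ C` and `Σ > 0`
  have hCpos : 0 < C := by
    obtain ⟨θ, hθ, h1, -⟩ := hL L₀ le_rfl
    exact lt_of_lt_of_le (mul_pos (pow_pos hθ 2) (sketchPub_blockVariance_pos L₀)) h1
  have hev := htend.eventually (gt_mem_nhds (show (0:ℝ) < 12 / C ^ 2 by positivity))
  obtain ⟨L₁, hL₁⟩ := Filter.eventually_atTop.1 hev
  set L := max L₀ L₁ with hLdef
  obtain ⟨θ, hθ, h1, h2⟩ := hL L (le_max_left _ _)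
  obtain ⟨m, n, b, -, -, -, -, -, -, hN⟩ := sketchPub_blockPackage L
  have hNew := hN θ hθ h2
  have hge := sketchPub_blockCoupling_ge hθ (sketchPub_blockVariance_pos L) h1 hNew
  have hlt := hL₁ L (le_max_right _ _)
  exact absurd hge (not_le.2 hlt)

end Summit.CriticalPhenomena.Ising3DConformalLimit.PerfectScreeningCoulombImpliesNontrivial

end
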